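import Summits.Ventures.CertifiedManyBodySolver.Downfold.EmeryOrbitalWeightCheck
import HarnessLib

/-!
# The Cu-d weight INCREASES MONOTONICALLY from the node to the antinode along every Fermi contour of a charge-transfer σ model — the sign of the Möbius
# function of `EmeryOrbitalWeightCheck` in closed form: `(pwB·dcharA − pwA·dcharB)·fsN = −4(Δ + ε)²·[fsN·(t_pd² + t_pp′ε) + (t_pp² − t_pp′²)·ε·(t_pd² − t_pp′ε)] < 0`

Venture CertifiedManyBodySolver, cell `pub/hubbard-downfold` (stage S1; INFLATION-RULES-3to1-B §B.72 (b): «node strictly less d-like than antinode» was a per-row kernel decision on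
34 + 34 + 5 + 8 + 5 σ sets; here it becomes a THEOREM for every set in the regime), seat hubbard-downfold-mod-4 (technique B, g28); namespace
`Summit.Ventures.CertifiedManyBodySolver.Downfold.Emery`. Sequel of `EmeryOrbitalWeightCheck` (`dWeight_on_contour`: on the `ε`-contour `w_d = 1 − (pwA + pwB·s)/(dcharA + dcharB·s)`,
`s = sin²(k_x/2) + sin²(k_y/2)`; `sum_mem_Icc_xNode_yFace`: `2·xNode ≤ s ≤ 1 + yFace` on the zone contour). Everything PROVED (0 sorry; elementary algebra). WHAT THIS IS NOT: a statement
about any material; `U = 0` one-body kinematics; the hypotheses are the cuprate regime `Δ + ε > 0`, `0 ≤ t_pp′ ≤ t_pp`, `fsN > 0`, `t_pd² > t_pp′ε` (i.e. `fsD > 0`).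

* §1 `moebius_sub`: `(A + Bs₂)/(C + Ds₂) − (A + Bs₁)/(C + Ds₁) = (BC − AD)(s₂ − s₁)/((C + Ds₂)(C + Ds₁))`.
* §2 THE KEY IDENTITY `moebiusDet_mul_fsN` and its sign `moebiusDet_neg`: the Möbius determinant `pwB·dcharA − pwA·dcharB` of the d-weight is NEGATIVE in the regime, so the
  O-weight fraction DECREASES and the Cu-d weight INCREASES with `s` along the contour.
* §3 `dWeight_lt_of_sum_lt`: two points of one zone contour with `s₁ < s₂` (energy denominators positive) have `w_d(1) < w_d(2)`; `dWeight_mem_Icc_node_face`: every zone Fermi point has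
  `w_d(node) ≤ w_d(k_F) ≤ w_d(antinode)` (ORDERED version of `dWeight_mem_uIcc_of_contour`), and `dWeight_node_lt_face` whenever the contour is not a single point.

Sources: three-band model [HybertsenSchluterChristensen1989, Eq. (1)]; [AndersenEtAl1995, §6]; [folklore] algebra.
-/

noncomputable section

namespace Summit.Ventures.CertifiedManyBodySolver.Downfold.Emery

open Real Set

/-! ## §1 Möbius differences -/

/-- Difference of a Möbius function at two points. [folklore] -/
theorem moebius_sub {A B C D s₁ s₂ : ℝ} (h₁ : C + D * s₁ ≠ 0) (h₂ : C + D * s₂ ≠ 0) :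
    (A + B * s₂) / (C + D * s₂) - (A + B * s₁) / (C + D * s₁) = (B * C - A * D) * (s₂ - s₁) / ((C + D * s₂) * (C + D * s₁)) := by
  rw [div_sub_div _ _ h₂ h₁]
  congr 1
  ring

/-- A Möbius function with NEGATIVE determinant `BC − AD` and positive denominators is strictly DECREASING. [folklore] -/
theorem moebius_strictAnti {A B C D s₁ s₂ : ℝ} (h₁ : 0 < C + D * s₁) (h₂ : 0 < C + D * s₂) (hdet : B * C - A * D < 0) (hs : s₁ < s₂) :
    (A + B * s₂) / (C + D * s₂) < (A + B * s₁) / (C + D * s₁) := by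
  have e := moebius_sub (A := A) (B := B) h₁.ne' h₂.ne'
  have hneg : (B * C - A * D) * (s₂ - s₁) / ((C + D * s₂) * (C + D * s₁)) < 0 :=
    div_neg_of_neg_of_pos (mul_neg_of_neg_of_pos hdet (sub_pos.2 hs)) (mul_pos h₂ h₁)
  linarith

/-! ## §2 The Möbius determinant of the d-weight and its sign -/

/-- The Möbius determinant of the O-weight fraction `(pwA + pwB·s)/(dcharA + dcharB·s)`: `pwB·dcharA − pwA·dcharB`. [folklore] -/
def moebiusDet (Δ tpd tpp c ε : ℝ) : ℝ := pwB tpd c ε * dcharA Δ tpd tpp c ε - pwA Δ ε * dcharB Δ tpd tpp c ε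

/-- **THE KEY IDENTITY**: `moebiusDet · fsN = −4(Δ + ε)²·[fsN·(t_pd² + t_pp′ε) + (t_pp² − t_pp′²)·ε·(t_pd² − t_pp′ε)]`. [folklore] -/
theorem moebiusDet_mul_fsN {Δ tpd tpp c ε : ℝ} (hN : fsN tpd tpp c ε ≠ 0) :
    moebiusDet Δ tpd tpp c ε * fsN tpd tpp c ε =
      -4 * (Δ + ε) ^ 2 * (fsN tpd tpp c ε * (tpd ^ 2 + c * ε) + dfsN tpp c * ε * (tpd ^ 2 - c * ε)) := by
  unfold moebiusDet pwA pwB dcharA dcharB dcA dfsD cA fsD fsD1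
  field_simp
  unfold fsN dfsN
  ring

/-- **THE SIGN**: in the regime (`Δ + ε > 0`, `0 ≤ t_pp′ ≤ t_pp`, `0 ≤ ε`, `fsN > 0`, `t_pd² > t_pp′ε`) the Möbius determinant is NEGATIVE. [folklore] -/
theorem moebiusDet_neg {Δ tpd tpp c ε : ℝ} (hΔε : 0 < Δ + ε) (hc : 0 ≤ c) (hg : c ≤ tpp) (hε : 0 ≤ ε) (hN : 0 < fsN tpd tpp c ε)
    (hD : c * ε < tpd ^ 2) : moebiusDet Δ tpd tpp c ε < 0 := by
  have key := moebiusDet_mul_fsN (Δ := Δ) hN.ne'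
  have hdf : 0 ≤ dfsN tpp c := by unfold dfsN; nlinarith
  have h1 : 0 < fsN tpd tpp c ε * (tpd ^ 2 + c * ε) := mul_pos hN (by nlinarith [mul_nonneg hc hε])
  have h2 : 0 ≤ dfsN tpp c * ε * (tpd ^ 2 - c * ε) := mul_nonneg (mul_nonneg hdf hε) (by linarith)
  have hsq : 0 < (Δ + ε) ^ 2 := by positivity
  have hrhs : -4 * (Δ + ε) ^ 2 * (fsN tpd tpp c ε * (tpd ^ 2 + c * ε) + dfsN tpp c * ε * (tpd ^ 2 - c * ε)) < 0 := by
    have : 0 < (Δ + ε) ^ 2 * (fsN tpd tpp c ε * (tpd ^ 2 + c * ε) + dfsN tpp c * ε * (tpd ^ 2 - c * ε)) := mul_pos hsq (by linarith)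
    linarith
  rw [← key] at hrhs
  -- moebiusDet * fsN < 0 with fsN > 0
  by_contra h
  push Not at h
  have : 0 ≤ moebiusDet Δ tpd tpp c ε * fsN tpd tpp c ε := mul_nonneg h hN.le
  linarith

/-! ## §3 Monotonicity of the d-weight along the contour -/

/-- **TWO POINTS OF ONE ZONE CONTOUR: the one with the larger `s = x + y` is MORE Cu-d-like** (regime as in `moebiusDet_neg`; positive energy denominators at both points).
[folklore] -/
theorem dWeight_lt_of_sum_lt {Δ tpd tpp c x₁ y₁ x₂ y₂ ε : ℝ} (hΔε : 0 < Δ + ε) (hc : 0 ≤ c) (hg : c ≤ tpp) (hε : 0 ≤ ε) (hN : 0 < fsN tpd tpp c ε)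
    (hD : c * ε < tpd ^ 2) (hP₁ : charCubic Δ tpd tpp c x₁ y₁ ε = 0) (hP₂ : charCubic Δ tpd tpp c x₂ y₂ ε = 0)
    (hW₁ : 0 < dcharCubic Δ tpd tpp c x₁ y₁ ε) (hW₂ : 0 < dcharCubic Δ tpd tpp c x₂ y₂ ε) (hs : x₁ + y₁ < x₂ + y₂) :
    dWeight Δ tpd tpp c x₁ y₁ ε < dWeight Δ tpd tpp c x₂ y₂ ε := by
  have hW₁' := hW₁
  have hW₂' := hW₂
  rw [dcharCubic_eq_affine hN.ne' hP₁] at hW₁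
  rw [dcharCubic_eq_affine hN.ne' hP₂] at hW₂
  rw [dWeight_on_contour hN.ne' hP₁ hW₁'.ne', dWeight_on_contour hN.ne' hP₂ hW₂'.ne']
  have hdet : pwB tpd c ε * dcharA Δ tpd tpp c ε - pwA Δ ε * dcharB Δ tpd tpp c ε < 0 := moebiusDet_neg hΔε hc hg hε hN hD
  have := moebius_strictAnti (A := pwA Δ ε) (B := pwB tpd c ε) hW₁ hW₂ hdet hs
  linarith

/-- **ALONG ONE ZONE FERMI CONTOUR THE Cu-d WEIGHT LIES BETWEEN ITS NODAL VALUE (BELOW) AND ITS ANTINODAL VALUE (ABOVE)** — the ordered form of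
`dWeight_mem_uIcc_of_contour` (regime: `Δ + ε > 0`, `0 ≤ t_pp′ ≤ t_pp`, `ε ≥ 0`, `fsN, fsD > 0`, positive energy denominators at `xNode` and `yFace`). [folklore] -/
theorem dWeight_mem_Icc_node_face {Δ tpd tpp c x y ε : ℝ} (hΔε : 0 < Δ + ε) (hc : 0 ≤ c) (hg : c ≤ tpp) (hε : 0 ≤ ε)
    (hN : 0 < fsN tpd tpp c ε) (hD : 0 < fsD Δ tpd c ε) (hN1 : fsN1 tpd tpp c ε ≠ 0)
    (hWn : 0 < dcharCubic Δ tpd tpp c (xNode Δ tpd tpp c ε) (xNode Δ tpd tpp c ε) ε)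
    (hWa : 0 < dcharCubic Δ tpd tpp c 1 (yFace Δ tpd tpp c ε) ε)
    (hx : x ∈ Set.Icc (0 : ℝ) 1) (hy : y ∈ Set.Icc (0 : ℝ) 1) (hP : charCubic Δ tpd tpp c x y ε = 0) :
    dWeight Δ tpd tpp c x y ε ∈ Set.Icc (dWeight Δ tpd tpp c (xNode Δ tpd tpp c ε) (xNode Δ tpd tpp c ε) ε)
      (dWeight Δ tpd tpp c 1 (yFace Δ tpd tpp c ε) ε) := by
  have hcε : c * ε < tpd ^ 2 := by
    unfold fsD at hD
    have := (mul_pos_iff_of_pos_left hΔε).1 hD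
    linarith
  have hF : 4 * fsD Δ tpd c ε + 16 * fsN tpd tpp c ε ≠ 0 := by positivity
  have hPn := charCubic_xNode (Δ := Δ) hN1
  have hPa := charCubic_yFace hF
  obtain ⟨hWs, _⟩ := dWeight_mem_uIcc_of_contour hN hD hε hN1 hWn hWa hx hy hP
  have hs := sum_mem_Icc_xNode_yFace hN hD hε hN1 hx hy hP
  constructor
  · rcases eq_or_lt_of_le hs.1 with h | h
    · -- equal sums ⇒ equal weights (both are the Möbius value at the same s)
      rw [dWeight_on_contour hN.ne' hPn hWn.ne', dWeight_on_contour hN.ne' hP hWs.ne', h]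
    · exact (dWeight_lt_of_sum_lt hΔε hc hg hε hN hcε hPn hP hWn hWs h).le
  · rcases eq_or_lt_of_le hs.2 with h | h
    · rw [dWeight_on_contour hN.ne' hP hWs.ne', dWeight_on_contour hN.ne' hPa hWa.ne', h]
    · exact (dWeight_lt_of_sum_lt hΔε hc hg hε hN hcε hP hPa hWs hWa h).le

/-- **NODE STRICTLY LESS Cu-d-LIKE THAN ANTINODE** whenever the contour is not degenerate (`2·xNode < 1 + yFace`). [folklore] -/
theorem dWeight_node_lt_face {Δ tpd tpp c ε : ℝ} (hΔε : 0 < Δ + ε) (hc : 0 ≤ c) (hg : c ≤ tpp) (hε : 0 ≤ ε)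
    (hN : 0 < fsN tpd tpp c ε) (hD : 0 < fsD Δ tpd c ε) (hN1 : fsN1 tpd tpp c ε ≠ 0)
    (hWn : 0 < dcharCubic Δ tpd tpp c (xNode Δ tpd tpp c ε) (xNode Δ tpd tpp c ε) ε)
    (hWa : 0 < dcharCubic Δ tpd tpp c 1 (yFace Δ tpd tpp c ε) ε)
    (hs : xNode Δ tpd tpp c ε + xNode Δ tpd tpp c ε < 1 + yFace Δ tpd tpp c ε) :
    dWeight Δ tpd tpp c (xNode Δ tpd tpp c ε) (xNode Δ tpd tpp c ε) ε < dWeight Δ tpd tpp c 1 (yFace Δ tpd tpp c ε) ε := by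
  have hcε : c * ε < tpd ^ 2 := by
    unfold fsD at hD
    have := (mul_pos_iff_of_pos_left hΔε).1 hD
    linarith
  have hF : 4 * fsD Δ tpd c ε + 16 * fsN tpd tpp c ε ≠ 0 := by positivity
  exact dWeight_lt_of_sum_lt hΔε hc hg hε hN hcε (charCubic_xNode (Δ := Δ) hN1) (charCubic_yFace hF) hWn hWa hs

end Summit.Ventures.CertifiedManyBodySolver.Downfold.Emery
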